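import Summits.QuantumFields.YangMills.Theorems.BalabanUVNodesK0Stub1RecordAveragingRightInverseGrad
import Summits.QuantumFields.YangMills.Theorems.BalabanUVNodesK0Stub1PairingsAtExtensions
import Summits.QuantumFields.YangMills.Theorems.BalabanUVNodesK0Stub1FibreTraceLetters
import Summits.QuantumFields.YangMills.Theorems.BalabanUVNodesN07ChartDDerivative
import HarnessLib

/-!
# K0⁷ STUB 1 (`stub_prop8StepCoP13`), sub-target S4b — THE CHART BLOCK OF THE SECT. F CAPSTONE AT THE RECORD, part 9 (A6):
# **THE PARAMETER BLOCK OF `K0Stub1SectFWSlotAtRecord.exists_sectF_W_atRecord_of_numericLetters` IS INHABITED AT EVERY SERVED FAMILY OF THE RECORD** — the fibre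
# letters (`τ_N = ntr`, dualiser `ρ_N`, `M_ρ = N³`), the pairings (27)∕(66) with a `B`-symmetric multiplier, a right inverse `H` of the true linearisation with BOTH
# (46) rows, and the `ε`-window, SIMULTANEOUSLY, for every admissible nested family on NODE 00's tori at P9's thresholds (A6 rule №189: no vacuous antecedent)

Cell `pub-ymgap`, width seat `pub-ymgap-k0-s1-w2` g3 (INTENT-9).  `--kind proof --supports stmt-QuantumFields-20541 --as helper`; count-neutral.
[15] = [Balaban1985Variational]; [B6] = [Balaban1984PropagatorsII].

WHAT IS PROVED (sorry-free; no definition; axioms standard).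
* ★★ `sectF_W_atRecord_parameters_inhabited` — for every `T4Family` `F` and `N ≥ 1` there are thresholds `Mh₀ R₀` such that for all heights `1 ≤ K − n`, `K − n + 1 ≤ m + K`,
  sizes `M_h = L^{a′} ≥ Mh₀`, `R ≥ max R₀ 2`, `a′ + 3 ≤ m + n`, every nested family `D` on `Site (F.P K) 0` with `D.k = K − n`, `Adm22 D R (L·M_h)`, and its level weights `w`:
  `∃ τ ρ BE B MV H` and numbers `M_ρ B₀ B₁ ε` satisfying ALL the parameter hypotheses of part 6's theorem at `(P, k) := (F.P K, K − n)` — `hρ hτ hτs hτ1 hMρ hρn hBE hB hBsymm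
  hMsym hHinv hB₀ hHB hB₁ hHgrad hε h18 h2` — by g0's `K0Stub1FibreTraceLetters.exists_fibreLetters`, p598821's `K0Stub1PairingsAtExtensions.exists_pairings_transposes_flatOps`
  (`c = L^k`, block weight `1`), part 7's `exists_rightInverse_chartLog_of_adm22_T4₂` (k0-s1-w3's port P9 underneath), and dag-n07-w2's `N07ChartDDerivative.exists_eps_chartDDeriv`.
HONEST SCOPE.  Non-vacuity only (the multiplier delivered is p598821's `M_V`; its η^d-multiple, the intended instance per dag k0-s1-w4's normalisation, is `B`-symmetric as well);
nothing of [15] asserted; `stub_prop8StepCoP13` ∕ K0⁷ NOT closed; N07 NOT discharged; counts unmoved (28∕28 · 5∕27); one finite 𝕋⁴ programme at fixed ε — R4 closes the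
conditional finite-𝕋⁴ rung `BalabanLadder.UV` only, never the summit; the YM mass gap (Clay) is NOT proved by any of this; nothing continuum ∕ ℝ⁴ ∕ OS.
No `sorry`, no `def`, no `instance`, no `notation`.

References: [15] (27) p.282, (45)–(46) p.285, (54) p.286, Prop. 3 p.289, Prop. 4 (97)–(98) pp.292–293, (157)–(158) p.302; [B6] (2.1)–(2.2) p.224, (2.35) p.228, Cor. 2.8 p.249.
-/

noncomputable section

open scoped BigOperators Matrix.Norms.L2Operator

namespace Summit.QuantumFields.YangMills.Theorems.K0Stub1SectFWSlotAtRecordInhabited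

open Literature.MathematicalPhysics.QuantumFieldTheory.Balaban1983to89
open Literature.MathematicalPhysics.QuantumFieldTheory.Balaban1983to89.T4Continuum (T4Family)
open Literature.MathematicalPhysics.QuantumFieldTheory.Balaban1983to89.B6SectADomainsV1 (Domains)
open Literature.MathematicalPhysics.QuantumFieldTheory.Balaban1983to89.B6SectAOperatorsV1 (BondIdx)
open B9Eq39Adjoint (bondPair)
open MatrixNorms (ntr)
open Summit.QuantumFields.YangMills.Theorems.FlatCubeOpsText (Adm22)
open Summit.QuantumFields.YangMills.Theorems.K0FlatCubeOpsTextP (IsLevWeight)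
open Summit.QuantumFields.YangMills.Theorems.Prop8Chart (chartLog)
open Summit.QuantumFields.YangMills.Theorems.K0Stub1PairingsAtExtensions (exists_pairings_transposes_flatOps)
open Summit.QuantumFields.YangMills.Theorems.K0Stub1FibreTraceLetters (exists_fibreLetters)
open Summit.QuantumFields.YangMills.Theorems.K0Stub1RecordAveragingRightInverseGrad (exists_rightInverse_chartLog_of_adm22_T4₂)
open Summit.QuantumFields.YangMills.BalabanUVNodes.N07ChartDDerivative (exists_eps_chartDDeriv)

/-- ★★ **A6 — THE PARAMETER BLOCK OF THE RECORD W-SLOT THEOREM IS INHABITED AT EVERY SERVED FAMILY** (see the module docstring).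
[cite: Balaban1985Variational, (27) p.282, (45)-(46) p.285, (54) p.286, Prop. 3 p.289; Balaban1984PropagatorsII, (2.1)-(2.2) p.224, Cor. 2.8 p.249] -/
theorem sectF_W_atRecord_parameters_inhabited (N : ℕ) [NeZero N] (F : T4Family) :
    ∃ (Mh₀ R₀ : ℕ), ∀ (n' K : ℕ) (_ : 1 ≤ K - n') (_ : K - n' + 1 ≤ F.m + K) {Mh R a' : ℕ} (_ : Mh = F.L ^ a') (_ : Mh₀ ≤ Mh) (_ : max R₀ 2 ≤ R)
      (_ : a' + 3 ≤ F.m + n') (D : Domains (F.P K)) (_ : D.k = K - n') (_ : Adm22 D R (F.L * Mh))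
      (w : ℕ → PBond (F.P K) 0 → ℝ) (_ : IsLevWeight (F.P K) (K - n') D w),
      ∃ (τ : Matrix (Fin N) (Fin N) ℂ →L[ℂ] ℂ) (ρ : (Matrix (Fin N) (Fin N) ℂ →L[ℂ] ℂ) →L[ℂ] Matrix (Fin N) (Fin N) ℂ)
        (BE : (PBond (F.P K) 0 → Matrix (Fin N) (Fin N) ℂ) →L[ℂ] (PBond (F.P K) 0 → Matrix (Fin N) (Fin N) ℂ) →L[ℂ] ℂ)
        (B : (BondIdx D → Matrix (Fin N) (Fin N) ℂ) →L[ℂ] (BondIdx D → Matrix (Fin N) (Fin N) ℂ) →L[ℂ] ℂ)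
        (MV : (BondIdx D → Matrix (Fin N) (Fin N) ℂ) →L[ℂ] (BondIdx D → Matrix (Fin N) (Fin N) ℂ))
        (H : (BondIdx D → Matrix (Fin N) (Fin N) ℂ) →ₗ[ℂ] (PBond (F.P K) 0 → Matrix (Fin N) (Fin N) ℂ))
        (Mρ B₀ B₁ ε : ℝ),
        -- the fibre letters
        (∀ X, τ X = ntr X) ∧ (∀ (ℓ' : Matrix (Fin N) (Fin N) ℂ →L[ℂ] ℂ) (X : Matrix (Fin N) (Fin N) ℂ), τ (ρ ℓ' * X) = ℓ' X) ∧
        (∀ a b : Matrix (Fin N) (Fin N) ℂ, τ (a * b) = τ (b * a)) ∧ (∀ a : Matrix (Fin N) (Fin N) ℂ, τ (star a) = starRingEnd ℂ (τ a)) ∧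
        (∀ X : Matrix (Fin N) (Fin N) ℂ, ‖τ X‖ ≤ ‖X‖) ∧ 0 ≤ Mρ ∧ (∀ ℓ' : Matrix (Fin N) (Fin N) ℂ →L[ℂ] ℂ, ‖ρ ℓ'‖ ≤ Mρ * ‖ℓ'‖) ∧
        -- the pairings and the multiplier
        (∀ Y δ : PBond (F.P K) 0 → Matrix (Fin N) (Fin N) ℂ, BE Y δ =
          bondPair ((((F.P K).L : ℝ))⁻¹ ^ (K - n')) (F.P K).d (τ : Matrix (Fin N) (Fin N) ℂ →ₗ[ℂ] ℂ) (fun μ x => Y ⟨x, μ⟩) (fun μ x => δ ⟨x, μ⟩)) ∧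
        (∀ X X' : BondIdx D → Matrix (Fin N) (Fin N) ℂ, B X X' = ∑ t, τ (X t * X' t)) ∧ (∀ a b, B a b = B b a) ∧ (∀ a b, B (MV a) b = B a (MV b)) ∧
        -- the right inverse with both (46) rows
        (∀ X, (fderiv ℂ (chartLog ((((F.P K).L : ℝ)⁻¹) ^ (K - n')) D :
            (PBond (F.P K) 0 → Matrix (Fin N) (Fin N) ℂ) → BondIdx D → Matrix (Fin N) (Fin N) ℂ) 0) (H X) = X) ∧
        0 ≤ B₀ ∧ (∀ (X : BondIdx D → Matrix (Fin N) (Fin N) ℂ) (t : ℝ), 0 ≤ t → (∀ i, ‖X i‖ ≤ t) → ∀ b, w 1 b * ‖H X b‖ ≤ B₀ * t) ∧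
        0 ≤ B₁ ∧ (∀ (X : BondIdx D → Matrix (Fin N) (Fin N) ℂ) (t : ℝ), 0 ≤ t → (∀ i, ‖X i‖ ≤ t) →
          ∀ (b : PBond (F.P K) 0) (ν : Fin (F.P K).d), w 2 b * ((F.P K).L : ℝ) ^ (K - n') * ‖H X ⟨b.src.shift ν, b.dir⟩ - H X b‖ ≤ B₁ * t) ∧
        -- the `ε`-window
        0 < ε ∧
        18 * (960 * ((((F.P K).d + 2) * (F.P K).L : ℕ) : ℝ) * ((F.P K).L : ℝ) / (12800 * ((((F.P K).d + 2) * (F.P K).L : ℕ) : ℝ) ^ 2 * ((F.P K).L : ℝ))⁻¹) * B₀ * ε ≤ 1 ∧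
        64 * ε ≤ (12800 * ((((F.P K).d + 2) * (F.P K).L : ℕ) : ℝ) ^ 2 * ((F.P K).L : ℝ))⁻¹ := by
  obtain ⟨Mh₀, R₀, B₀, hB₀, hmain⟩ := exists_rightInverse_chartLog_of_adm22_T4₂ (n := Fin N) F
  refine ⟨Mh₀, R₀, ?_⟩
  intro n' K hk1 hk' Mh R a' hMha hMh hR hsize D hDk hAdm w hw
  -- the two-row right inverse
  obtain ⟨H, hHinv, hHB, hHgrad⟩ := hmain n' K hk1 hk' hMha hMh hR hsize D hDk hAdm w hw
  -- g0's fibre letters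
  obtain ⟨τ, ρ, hntr, hτ, hτs, hτ1, -, hρ, hρn⟩ := exists_fibreLetters N
  -- p598821's pairings and multiplier (`c = L^{K−n}`, block weight `1`)
  have hL0 : (0 : ℝ) < (F.P K).L := by exact_mod_cast (F.P K).L_pos
  have hη : ((((F.P K).L : ℝ))⁻¹ ^ (K - n')) ≠ 0 := by positivity
  have hck : (((F.P K).L : ℝ) ^ (K - n')) ≠ 0 := by positivity
  obtain ⟨BE, B, -, -, MV, -, -, hBE, hB, -, -, -, -, -, hBsymm, hMsym, -, -⟩ :=
    exists_pairings_transposes_flatOps D hck (w := fun _ : BondIdx D => (1 : ℝ)) (fun _ => one_pos)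
      (𝔸 := Matrix (Fin N) (Fin N) ℂ) hη (τ : Matrix (Fin N) (Fin N) ℂ →ₗ[ℂ] ℂ) hτ
  -- the `ε`-window for the sup constant
  have hℓ1 : (1 : ℝ) ≤ ((((F.P K).d + 2) * (F.P K).L : ℕ) : ℝ) := by
    exact_mod_cast Nat.one_le_iff_ne_zero.mpr (Nat.mul_ne_zero (by omega) (by have := (F.P K).hL.2; omega))
  have hC₂ : 0 ≤ 960 * ((((F.P K).d + 2) * (F.P K).L : ℕ) : ℝ) * ((F.P K).L : ℝ) /
      (12800 * ((((F.P K).d + 2) * (F.P K).L : ℕ) : ℝ) ^ 2 * ((F.P K).L : ℝ))⁻¹ := by positivity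
  have hRs : 0 < (12800 * ((((F.P K).d + 2) * (F.P K).L : ℕ) : ℝ) ^ 2 * ((F.P K).L : ℝ))⁻¹ := by positivity
  have hB₀' : 0 ≤ B₀ * ((1 + 2 * ((4 + 2) * F.L : ℕ)) * (1 + 8 * ((4 + 2) * F.L : ℕ) + 8 * ((4 + 2) * F.L : ℕ) * F.L)) := by positivity
  obtain ⟨ε, hε, h18, h2⟩ := exists_eps_chartDDeriv hC₂ hB₀' hRs
  refine ⟨τ, ρ, BE, B, MV, H, (N : ℝ) ^ 3, _, _, ε, hntr, hρ, hτ, hτs, hτ1, by positivity, hρn, hBE, hB, hBsymm, hMsym, hHinv, hB₀', hHB, by positivity, hHgrad,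
    hε, ?_, h2⟩
  simpa only [mul_assoc] using h18

end Summit.QuantumFields.YangMills.Theorems.K0Stub1SectFWSlotAtRecordInhabited

end
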